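import Summits.QuantumFields.QCD.Theses.NestedDissectionSea
import Summits.QuantumFields.QCD.Theorems.CoerciveSea.Negative.PinWindow

/-!
# Helper for stub `stub_physicalBranch` of line `proper-time-quarantine`
(crux `Summit.QuantumFields.QCD.Theses.NestedDissectionSea.SeaFactorisationBridge`,
item stmt-QuantumFields-13880): the pin window, read on the VALENCE masses

The line reuses the hinge's regularisation `reg` (`CoerciveSea`, stmt-QuantumFields-13901), so
`IsQCDAlong` needs its bare valence masses `m_f(k) = m_crit(k) + a_k m_f / Z_m(k)` eventually on
the physical branch `> -1`.  The only clause of the hinge that constrains the free datum `m_crit`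
deterministically is the parity pin (iii) — VERBATIM `CoerciveSeaNegative.PinClause Nf reg M₀ m R`
(the skeleton's `CoerciveAt Nf reg M₀ b₀ ℓ m` unfolds to `∃ R, 0 < R ∧ (i) ∧ (ii) ∧ PinClause Nf reg M₀ m R`).
What the pin gives, transported from the pin masses `m_crit(k) - a_k M / Z_m(k) ∈ (-8, 0)`
(`PinClause.mass_mem_Ioo`: Seiler positivity on both sides of the hopping band) to the valence
masses, with no sign or scaling hypothesis:

* `pin_valenceOffset_lt` — every valence offset is eventually small: `a_k μ / Z_m(k) < η`
  (two pin depths `8(|μ|+1)/η` apart both sit in a window of length `8`; the `ε`-form of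
  `PinClause.tendsto_valenceOffset`);
* `pin_neg_eight_lt_valenceMass` — for EVERY flavour, eventually `-8 < m_crit(k) + a_k m_f / Z_m(k)`;
* `pin_valenceMass_lt` — eventually `m_crit(k) + a_k m_f / Z_m(k) < η` for every `η > 0`;
* `pin_valenceMass_mem_Ioo` — both, uniformly in the flavour: eventually every valence mass lies
  in `(-8, η)`; `physicalBranch_neg_eight` — the same in the shape of the stub (`-1` weakened to
  `-8`, `CoerciveAt` weakened to its clause (iii));
* `pin_mcrit_gt_of_branch` / `branch_of_neg_one_le_mcrit` — under the pin, the physical branch at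
  one flavour forces `m_crit(k) > -1 - η` eventually, and conversely `-1 ≤ m_crit(k)` eventually
  gives the branch at every tuple of positive masses: modulo the pin, the stub IS the statement
  `liminf_k m_crit(k) ≥ -1` about the hinge's free datum, which no clause of `CoerciveSea`
  supplies (for `μ` strictly between two critical lines the pin event `Re det D_W(U, μ, 1) < 0` is
  the event "an odd number of real Wilson modes lies below `-μ`", so (iii) does not separate the
  physical line from the doubler strip `(-8, -1]`).
-/

noncomputable section

namespace Summit.QuantumFields.QCD.Cruxes.SeaFactorisationBridge.ProperTimeQuarantine

open Filter
open Literature.MathematicalPhysics.QuantumFieldTheory Literature.MathematicalPhysics.QuantumLattice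
open Literature.Probability.LatticeModels
open Summit.QuantumFields.QCD.Theorems.CoerciveSeaNegative

/-- **Pin ⇒ every valence offset is eventually small** (`ε`-form of
`PinClause.tendsto_valenceOffset`, from `PinClause.mass_mem_Ioo` alone): for every real `μ` and
`η > 0`, eventually `a_k μ / Z_m(k) < η`. The pin windows at the depths `M₀ + 1` and
`M₀ + 1 + 8(|μ|+1)/η` give `m_crit(k) < a_k (M₀+1)/Z_m(k)` and
`-8 < m_crit(k) - a_k (M₀ + 1 + 8(|μ|+1)/η)/Z_m(k)`, whence `(a_k/Z_m(k)) · 8(|μ|+1)/η < 8`. -/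
theorem pin_valenceOffset_lt {Nf : ℕ} {reg : QCDRegularisation Nf} {M₀ : ℝ}
    {m : Fin Nf → ℝ} {R : ℝ} (h : PinClause Nf reg M₀ m R) (μ : ℝ) {η : ℝ} (hη : 0 < η) :
    ∀ᶠ k : ℕ in atTop, reg.a k * μ / reg.Zm k < η := by
  set A : ℝ := |μ| + 1 with hA
  have hApos : 0 < A := by positivity
  have hc : 0 < 8 * A / η := by positivity
  have h1 := h.mass_mem_Ioo (M := M₀ + 1) (by linarith)
  have h2 := h.mass_mem_Ioo (M := M₀ + 1 + 8 * A / η) (by linarith)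
  filter_upwards [h1, h2] with k hk1 hk2
  set q : ℝ := reg.a k / reg.Zm k with hq
  have hqpos : 0 < q := div_pos (reg.a_pos k) (reg.Zm_pos k)
  have hre : ∀ X : ℝ, reg.a k * X / reg.Zm k = q * X := fun X => by rw [hq]; ring
  rw [hre] at hk1 hk2 ⊢
  have h3 : q * (8 * A / η) < 8 := by linarith [hk1.2, hk2.1]
  have h4 : q * A < η := by
    have e : q * (8 * A / η) = q * A * 8 / η := by ring
    rw [e, div_lt_iff₀ hη] at h3
    linarith
  have h5 : q * μ ≤ q * A := by
    apply mul_le_mul_of_nonneg_left _ hqpos.le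
    linarith [le_abs_self μ]
  linarith

/-- **Lower side of the pin window on the valence masses.** If the pin clause (iii) of the hinge
holds for `(reg, M₀, m, R)`, then for every flavour `fl` — whatever the sign of `m fl` —
eventually `-8 < m_crit(k) + a_k m_fl / Z_m(k)`: the pin at depth `M = max M₀ (-m fl) + 1`
gives `-8 < m_crit(k) - a_k M / Z_m(k)` (`PinClause.mass_mem_Ioo`), and
`a_k (M + m_fl) / Z_m(k) ≥ 0`. -/
theorem pin_neg_eight_lt_valenceMass {Nf : ℕ} {reg : QCDRegularisation Nf} {M₀ : ℝ}
    {m : Fin Nf → ℝ} {R : ℝ} (h : PinClause Nf reg M₀ m R) (fl : Fin Nf) :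
    ∀ᶠ k : ℕ in atTop, -8 < reg.mcrit k + reg.a k * m fl / reg.Zm k := by
  have hM : M₀ < max M₀ (-m fl) + 1 := by linarith [le_max_left M₀ (-m fl)]
  filter_upwards [h.mass_mem_Ioo hM] with k hk
  have ha := reg.a_pos k
  have hZ := reg.Zm_pos k
  have hsum : 0 ≤ max M₀ (-m fl) + 1 + m fl := by linarith [le_max_right M₀ (-m fl)]
  have h0 : 0 ≤ reg.a k * (max M₀ (-m fl) + 1 + m fl) / reg.Zm k := by positivity
  have hsplit : reg.mcrit k + reg.a k * m fl / reg.Zm k =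
      (reg.mcrit k - reg.a k * (max M₀ (-m fl) + 1) / reg.Zm k) +
        reg.a k * (max M₀ (-m fl) + 1 + m fl) / reg.Zm k := by
    field_simp
    ring
  rw [hsplit]
  linarith [hk.1]

/-- **Upper side of the pin window on the valence masses.** Under the pin clause, for every
flavour and every `η > 0`, eventually `m_crit(k) + a_k m_fl / Z_m(k) < η`:
`m_crit(k) < a_k (M₀+1)/Z_m(k)` (`PinClause.mass_mem_Ioo`) and the offsets
`a_k (M₀+1)/Z_m(k)`, `a_k m_fl/Z_m(k)` are eventually below `η/2` (`pin_valenceOffset_lt`). -/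
theorem pin_valenceMass_lt {Nf : ℕ} {reg : QCDRegularisation Nf} {M₀ : ℝ}
    {m : Fin Nf → ℝ} {R : ℝ} (h : PinClause Nf reg M₀ m R) (fl : Fin Nf) {η : ℝ} (hη : 0 < η) :
    ∀ᶠ k : ℕ in atTop, reg.mcrit k + reg.a k * m fl / reg.Zm k < η := by
  have h1 := h.mass_mem_Ioo (M := M₀ + 1) (by linarith)
  have h2 := pin_valenceOffset_lt h (M₀ + 1) (half_pos hη)
  have h3 := pin_valenceOffset_lt h (m fl) (half_pos hη)
  filter_upwards [h1, h2, h3] with k hk1 hk2 hk3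
  linarith [hk1.2]

/-- **The pin window on the valence masses**, uniformly in the flavour: under the pin clause, for
every `η > 0`, eventually in `k` EVERY valence mass `m_crit(k) + a_k m_f / Z_m(k)` lies in the
open interval `(-8, η)`. This is all the pin says about the branch: the physical-branch clause
`-1 < m_f(k)` of `IsQCDAlong` is thereby equivalent, eventually, to excluding the doubler strip
`(-8, -1]`. -/
theorem pin_valenceMass_mem_Ioo {Nf : ℕ} {reg : QCDRegularisation Nf} {M₀ : ℝ}
    {m : Fin Nf → ℝ} {R : ℝ} (h : PinClause Nf reg M₀ m R) {η : ℝ} (hη : 0 < η) :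
    ∀ᶠ k : ℕ in atTop, ∀ fl : Fin Nf,
      reg.mcrit k + reg.a k * m fl / reg.Zm k ∈ Set.Ioo (-8 : ℝ) η := by
  refine eventually_all.2 fun fl => ?_
  filter_upwards [pin_neg_eight_lt_valenceMass h fl, pin_valenceMass_lt h fl hη] with k hk1 hk2
  exact ⟨hk1, hk2⟩

/-- **Branch ⇒ `liminf m_crit ≥ -1`.** Under the pin clause, if ONE flavour is eventually on the
physical branch, then `-1 - η < m_crit(k)` eventually for every `η > 0` (the valence offset is
eventually below `η`, `pin_valenceOffset_lt`). -/
theorem pin_mcrit_gt_of_branch {Nf : ℕ} {reg : QCDRegularisation Nf} {M₀ : ℝ}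
    {m : Fin Nf → ℝ} {R : ℝ} (h : PinClause Nf reg M₀ m R) {fl : Fin Nf}
    (hbr : ∀ᶠ k : ℕ in atTop, -1 < reg.mcrit k + reg.a k * m fl / reg.Zm k) {η : ℝ} (hη : 0 < η) :
    ∀ᶠ k : ℕ in atTop, -1 - η < reg.mcrit k := by
  filter_upwards [hbr, pin_valenceOffset_lt h (m fl) hη] with k hk1 hk2
  linarith

/-- **`-1 ≤ m_crit` eventually ⇒ branch** (no pin needed): at every tuple of positive masses the
valence offset `a_k m_fl / Z_m(k)` is positive, so `-1 ≤ m_crit(k)` eventually puts every valence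
mass eventually on the physical branch. Together with `pin_mcrit_gt_of_branch`: modulo the pin,
the branch statement of `stub_physicalBranch` is the assertion `liminf_k m_crit(k) ≥ -1` on the
hinge's free datum `m_crit`. -/
theorem branch_of_neg_one_le_mcrit {Nf : ℕ} (reg : QCDRegularisation Nf) {m : Fin Nf → ℝ}
    (hm : ∀ f, 0 < m f) (hc : ∀ᶠ k : ℕ in atTop, -1 ≤ reg.mcrit k) (fl : Fin Nf) :
    ∀ᶠ k : ℕ in atTop, -1 < reg.mcrit k + reg.a k * m fl / reg.Zm k := by
  filter_upwards [hc] with k hk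
  have hpos : 0 < reg.a k * m fl / reg.Zm k :=
    div_pos (mul_pos (reg.a_pos k) (hm fl)) (reg.Zm_pos k)
  linarith

/-- **The harvest in the shape of the stub.** For `N_f ∈ {2,3}`, any regularisation, thresholds
`M₀ ≥ 0`, `b₀ ≥ 2`, window `ℓ > 0` and tuple `m > M₀`: the pin clause (iii) of the hinge at `m`
(for some physical size `R > 0`) puts every valence mass eventually above `-8` — the statement of
`stub_physicalBranch` with `-1` weakened to `-8` and `CoerciveAt` weakened to its clause (iii). -/
theorem physicalBranch_neg_eight :
    ∀ Nf : ℕ, (Nf = 2 ∨ Nf = 3) → ∀ reg : QCDRegularisation Nf, ∀ (M₀ : ℝ) (b₀ : ℕ) (ℓ : ℝ), 0 ≤ M₀ → 2 ≤ b₀ → 0 < ℓ → ∀ m : Fin Nf → ℝ, (∀ f, M₀ < m f) → (∃ R : ℝ, 0 < R ∧ PinClause Nf reg M₀ m R) → ∀ fl : Fin Nf, ∀ᶠ k : ℕ in atTop, -8 < reg.mcrit k + reg.a k * m fl / reg.Zm k := by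
  intro Nf _ reg M₀ b₀ ℓ _ _ _ m _ hpin fl
  obtain ⟨R, -, h⟩ := hpin
  exact pin_neg_eight_lt_valenceMass h fl

end Summit.QuantumFields.QCD.Cruxes.SeaFactorisationBridge.ProperTimeQuarantine

end
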